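import Summits.Ventures.PercRepro.RankLevelSetLevelFiveCqNineteen
import Summits.Ventures.PercRepro.S2CoreSeventeenSplit
import Summits.Ventures.PercRepro.S2CoreSeventeen
import Summits.Ventures.PercRepro.S2CobasisCoreSixT
import Summits.Ventures.PercRepro.S2CellsP17B
import Summits.Ventures.PercRepro.S2CellsP17R
import Summits.Ventures.PercRepro.S2CellsP17RB

/-!
# PercRepro — THEOREM C₅ AT `18`: C-025 AT LEVEL `5` FOR EVERY `p ≥ 18` (p7, gen 8; sub-claim S2; the «18» assembly)

The `p = 17` row of the cell map, closed by FOUR levers on top of the «19» kit: p8's nullity-`3` total cap and its averaging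
chain `s₄ ≤ avgChain16 d` (RankLevelSetFourCircuitNullityFour: `46 / 69 / 99 / 138 / 188 / …` against p2's `53 / 79 / 114 / 159 /
216 / …`) on every cell; the SHARP corank-`10` mid count `N_mid ≤ 1716·⌊(|E| − 8)/2⌋ = 15444` at `|E| = 27` (S2MidFlatsTenD, from
`136,092`) at `d = 10`; the SERIES-CLASS averaging `s₄ ≤ 46` on the coloop-free `(17, 7)` core (S2SeriesCapSeven) with the coloop
split and the coloop-free `5`-circuit cap (S2CapFree) at `d = 7, 8, 9` (S2CoreSeventeenSplit — at `d = 8` the split is iterated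
once); the quart core with `avgChain5b` at every `11 ≤ d ≤ 31` (on the square-weight XQICT core these read up to `1.32`); and the
corank-`≥ 32` regime by the sizes `6 … 16` (S2CoreSeventeen, from `n₀ = 49` — the coranks `30`, `31` are cells). Every cell
`(17, d)`, `6 ≤ d ≤ 31`, reads `≤ 0.994` (`(17, 6)`: `0.987`; `(17, 7)`: `0.994` / `0.985`; `(17, 8)`: `0.983` / `0.957` / `0.975`;
`(17, 9)`: `0.925` / `0.946`; `(17, 10)`: `0.762`; `(17, 31)`: `0.986`). Declarations:
* `S2.cellsP17Q` — the 21 quart-core cells dispatched (`cq3 d` / `avgChain16 d` / `avgChain5b d` by `decide +kernel`);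
* `c025_core_five_seventeen_six / _ten` — the cobasis cell and the corank-`10` cell on the sharp mid count;
* **`c025_core_five_seventeen_xx`** — the `e`-free core at level `5`, rank `17`, every corank `6 ≤ d ≤ 31`;
* **`c025_five_of_four_cq_xviii_from`** — for `P ≥ 17`, level `4` for all `p ≥ P` implies level `5` for all `p ≥ P + 1`;
* **`c025_five_large_sharp18`** — UNCONDITIONAL over the landed tree: C-025 at level `5` for every `p ≥ 18` (level `4` from
  S1's `c025_four_seventeen`); `c025_five_large_sharp18'` is the `C025` spelling.
Axioms: standard. -/

open scoped Matroid

namespace PercRepro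

namespace S2

/-- **The `p = 17` cells on the quart core, dispatched**: for every corank `11 ≤ d ≤ 31`, some slack `m ≤ 1024` with
`1024·U‴(17, d) ≤ (1024 − m)·2^(d−5)·C(22, 5)` and `1024·T‴(17 + d, d) ≤ m·2^(17+d)`, at `s3b = cq3 d`, `s4b = avgChain16 d`
(p8) and `s5b = avgChain5b d` (p2). -/
theorem cellsP17Q (d : ℕ) (hd11 : 11 ≤ d) (hd31 : d ≤ 31) :
    ∃ m : ℕ, m ≤ 1024 ∧
      (1024 * ((((17 + d).choose 5 : ℚ) - (TriangleCap.cq3 d : ℚ) * ((17 + d - 3).choose 2 : ℚ) +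
        (((TriangleCap.cq3 d).choose 2 : ℕ) : ℚ)) +
      (∑ j ∈ Finset.range (d - 5), (Nat.choose (min 13 ((d + 6) / 2 + 1 - 2)) j : ℚ) / (((j + 1) + 3 * (j + 1).choose 2 + 3 * (j + 1).choose 3 + 2 * (j + 1).choose 4 : ℕ) : ℚ)) *
        ((TriangleCap.cq3 d * (17 + d - 3).choose 3 + ThmN.avgChain16 d * (17 + d - 4).choose 2 + S1.avgChain5b d * (17 + d - 5) + (d + 5).choose 6 : ℕ) : ℚ) +
      ((∑ j ∈ Finset.range (d - 5), (Nat.choose (min 19 (5 + d) - 6) j : ℚ) / (((j + 1) + 3 * (j + 1).choose 2 + 3 * (j + 1).choose 3 + 2 * (j + 1).choose 4 : ℕ) : ℚ)) -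
        (∑ j ∈ Finset.range (d - 5), (Nat.choose (min 13 ((d + 6) / 2 + 1 - 2)) j : ℚ) / (((j + 1) + 3 * (j + 1).choose 2 + 3 * (j + 1).choose 3 + 2 * (j + 1).choose 4 : ℕ) : ℚ))) *
        ((min 19 (5 + d)).choose 6 : ℚ)) ≤
        ((1024 - m : ℕ) : ℚ) * 2 ^ (d - 5) * ((17 + 5).choose 5 : ℚ)) ∧
      (1024 * ((((17 + d).choose 4 : ℚ) +
      (∑ j ∈ Finset.range 6, (Nat.choose (min 5 ((d + 3) / 2 + 1 - 2)) j : ℚ) / (((j + 1) + 3 * (j + 1).choose 2 + 3 * (j + 1).choose 3 + 2 * (j + 1).choose 4 : ℕ) : ℚ)) *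
        ((TriangleCap.cq3 d * (17 + d - 3).choose 2 + ThmN.avgChain16 d * (17 + d - 4) + S1.avgChain5b d : ℕ) : ℚ) +
      ((∑ j ∈ Finset.range 6, (Nat.choose 5 j : ℚ) / (((j + 1) + 3 * (j + 1).choose 2 + 3 * (j + 1).choose 3 + 2 * (j + 1).choose 4 : ℕ) : ℚ)) -
        (∑ j ∈ Finset.range 6, (Nat.choose (min 5 ((d + 3) / 2 + 1 - 2)) j : ℚ) / (((j + 1) + 3 * (j + 1).choose 2 + 3 * (j + 1).choose 3 + 2 * (j + 1).choose 4 : ℕ) : ℚ))) *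
        ((10 : ℕ).choose 5 : ℚ)) +
      (((17 + d).choose 3 * 2 ^ 3 + (17 + d).choose 2 * 2 + (17 + d) + 1 : ℕ) : ℚ) +
      (((17 + d).choose 5 : ℚ) + (∑ j ∈ Finset.range (d), (Nat.choose (min 13 ((d + 6) / 2 + 1 - 2)) j : ℚ) / (((j + 1) + 3 * (j + 1).choose 2 + 3 * (j + 1).choose 3 + 2 * (j + 1).choose 4 : ℕ) : ℚ)) * ((TriangleCap.cq3 d * (17 + d - 3).choose 3 + ThmN.avgChain16 d * (17 + d - 4).choose 2 + S1.avgChain5b d * (17 + d - 5) + (d + 5).choose 6 : ℕ) : ℚ) +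
        ((∑ j ∈ Finset.range (d), (Nat.choose (min 19 (5 + d) - 6) j : ℚ) / (((j + 1) + 3 * (j + 1).choose 2 + 3 * (j + 1).choose 3 + 2 * (j + 1).choose 4 : ℕ) : ℚ)) - (∑ j ∈ Finset.range (d), (Nat.choose (min 13 ((d + 6) / 2 + 1 - 2)) j : ℚ) / (((j + 1) + 3 * (j + 1).choose 2 + 3 * (j + 1).choose 3 + 2 * (j + 1).choose 4 : ℕ) : ℚ))) *
        ((min 19 (5 + d)).choose 6 : ℚ)) +
      ((∑ j ∈ Finset.range (d + 1), (17 + d).choose j : ℕ) : ℚ)) ≤ (m : ℚ) * 2 ^ (17 + d)) := by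
  interval_cases d
  · rw [show TriangleCap.cq3 11 = 24 by decide +kernel, show ThmN.avgChain16 11 = 250 by decide +kernel,
      show S1.avgChain5b 11 = 2208 by decide +kernel]
    exact ⟨182, by norm_num, cellP17Q_11_poly, cellP17Q_11_tail⟩
  · rw [show TriangleCap.cq3 12 = 29 by decide +kernel, show ThmN.avgChain16 12 = 326 by decide +kernel,
      show S1.avgChain5b 12 = 3128 by decide +kernel]
    exact ⟨240, by norm_num, cellP17Q_12_poly, cellP17Q_12_tail⟩
  · rw [show TriangleCap.cq3 13 = 34 by decide +kernel, show ThmN.avgChain16 13 = 419 by decide +kernel,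
      show S1.avgChain5b 13 = 4331 by decide +kernel]
    exact ⟨303, by norm_num, cellP17Q_13_poly, cellP17Q_13_tail⟩
  · rw [show TriangleCap.cq3 14 = 40 by decide +kernel, show ThmN.avgChain16 14 = 530 by decide +kernel,
      show S1.avgChain5b 14 = 5877 by decide +kernel]
    exact ⟨372, by norm_num, cellP17Q_14_poly, cellP17Q_14_tail⟩
  · rw [show TriangleCap.cq3 15 = 47 by decide +kernel, show ThmN.avgChain16 15 = 662 by decide +kernel,
      show S1.avgChain5b 15 = 7836 by decide +kernel]
    exact ⟨443, by norm_num, cellP17R_15_poly, cellP17R_15_tail⟩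
  · rw [show TriangleCap.cq3 16 = 54 by decide +kernel, show ThmN.avgChain16 16 = 817 by decide +kernel,
      show S1.avgChain5b 16 = 10284 by decide +kernel]
    exact ⟨514, by norm_num, cellP17R_16_poly, cellP17R_16_tail⟩
  · rw [show TriangleCap.cq3 17 = 62 by decide +kernel, show ThmN.avgChain16 17 = 998 by decide +kernel,
      show S1.avgChain5b 17 = 13308 by decide +kernel]
    exact ⟨583, by norm_num, cellP17R_17_poly, cellP17R_17_tail⟩
  · rw [show TriangleCap.cq3 18 = 71 by decide +kernel, show ThmN.avgChain16 18 = 1208 by decide +kernel,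
      show S1.avgChain5b 18 = 17004 by decide +kernel]
    exact ⟨649, by norm_num, cellP17R_18_poly, cellP17R_18_tail⟩
  · rw [show TriangleCap.cq3 19 = 81 by decide +kernel, show ThmN.avgChain16 19 = 1449 by decide +kernel,
      show S1.avgChain5b 19 = 21478 by decide +kernel]
    exact ⟨709, by norm_num, cellP17R_19_poly, cellP17R_19_tail⟩
  · rw [show TriangleCap.cq3 20 = 92 by decide +kernel, show ThmN.avgChain16 20 = 1725 by decide +kernel,
      show S1.avgChain5b 20 = 26847 by decide +kernel]
    exact ⟨763, by norm_num, cellP17R_20_poly, cellP17R_20_tail⟩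
  · rw [show TriangleCap.cq3 21 = 104 by decide +kernel, show ThmN.avgChain16 21 = 2038 by decide +kernel,
      show S1.avgChain5b 21 = 33239 by decide +kernel]
    exact ⟨811, by norm_num, cellP17R_21_poly, cellP17R_21_tail⟩
  · rw [show TriangleCap.cq3 22 = 117 by decide +kernel, show ThmN.avgChain16 22 = 2392 by decide +kernel,
      show S1.avgChain5b 22 = 40793 by decide +kernel]
    exact ⟨852, by norm_num, cellP17R_22_poly, cellP17R_22_tail⟩
  · rw [show TriangleCap.cq3 23 = 131 by decide +kernel, show ThmN.avgChain16 23 = 2790 by decide +kernel,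
      show S1.avgChain5b 23 = 49661 by decide +kernel]
    exact ⟨887, by norm_num, cellP17R_23_poly, cellP17R_23_tail⟩
  · rw [show TriangleCap.cq3 24 = 146 by decide +kernel, show ThmN.avgChain16 24 = 3236 by decide +kernel,
      show S1.avgChain5b 24 = 60007 by decide +kernel]
    exact ⟨917, by norm_num, cellP17R_24_poly, cellP17R_24_tail⟩
  · rw [show TriangleCap.cq3 25 = 162 by decide +kernel, show ThmN.avgChain16 25 = 3733 by decide +kernel,
      show S1.avgChain5b 25 = 72008 by decide +kernel]
    exact ⟨941, by norm_num, cellP17R_25_poly, cellP17R_25_tail⟩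
  · rw [show TriangleCap.cq3 26 = 179 by decide +kernel, show ThmN.avgChain16 26 = 4286 by decide +kernel,
      show S1.avgChain5b 26 = 85855 by decide +kernel]
    exact ⟨960, by norm_num, cellP17R_26_poly, cellP17R_26_tail⟩
  · rw [show TriangleCap.cq3 27 = 197 by decide +kernel, show ThmN.avgChain16 27 = 4898 by decide +kernel,
      show S1.avgChain5b 27 = 101754 by decide +kernel]
    exact ⟨975, by norm_num, cellP17R_27_poly, cellP17R_27_tail⟩
  · rw [show TriangleCap.cq3 28 = 216 by decide +kernel, show ThmN.avgChain16 28 = 5573 by decide +kernel,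
      show S1.avgChain5b 28 = 119924 by decide +kernel]
    exact ⟨987, by norm_num, cellP17R_28_poly, cellP17R_28_tail⟩
  · rw [show TriangleCap.cq3 29 = 236 by decide +kernel, show ThmN.avgChain16 29 = 6316 by decide +kernel,
      show S1.avgChain5b 29 = 140600 by decide +kernel]
    exact ⟨997, by norm_num, cellP17R_29_poly, cellP17R_29_tail⟩
  · rw [show TriangleCap.cq3 30 = 465 by decide +kernel, show ThmN.avgChain16 30 = 7130 by decide +kernel,
      show S1.avgChain5b 30 = 164033 by decide +kernel]
    exact ⟨1004, by norm_num, cellP17R_30_poly, cellP17R_30_tail⟩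
  · rw [show TriangleCap.cq3 31 = 496 by decide +kernel, show ThmN.avgChain16 31 = 8021 by decide +kernel,
      show S1.avgChain5b 31 = 190489 by decide +kernel]
    exact ⟨1010, by norm_num, cellP17R_31_poly, cellP17R_31_tail⟩

end S2

namespace ThmN

open Set

variable {α : Type}

/-- **The `e`-free core at level `5`, rank `17`, corank `6`**: the cobasis core with `s₃ ≤ 10` (cq3 6), `s₄ ≤ 46`
(p8's `avgChain16 6`), `s₅ ≤ 234` (p2's `avgChain5b 6`); slack `36/1024`. -/
theorem c025_core_five_seventeen_six (M : Matroid α) [M.Finite]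
    (hR : M.eRank = ((17 : ℕ) : ℕ∞)) (hn : M.E.ncard = 17 + 6)
    (hfree : ∀ e ∈ M.E, ∃ A ⊆ M.E \ {e}, e ∉ M.closure A ∧ e ∉ M.closure ((M.E \ {e}) \ A)) :
    RLS M 17 5 := by
  have hd : M.E.encard = M.eRank + ((6 : ℕ) : ℕ∞) := by
    rw [hR, ← M.ground_finite.cast_ncard_eq, hn]
    push_cast
    ring
  have hs3 := TriangleCap.core_ncard_triangles_le_cq3 M hfree hd
  rw [show TriangleCap.cq3 6 = 10 by decide +kernel] at hs3
  have hs4 := ncard_fourCircuits_le_avgChain16 6 M hfree hd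
  rw [show avgChain16 6 = 46 by decide +kernel] at hs4
  have hs5 := S1.ncard_fiveCircuits_le_two_thirty_four M hfree (by exact_mod_cast hd)
  exact c025_core_five_cobasis_six_cell_t M 17 (by norm_num) hR hn hfree 10 46 234 hs3 hs4 hs5
    ⟨36, by norm_num, S2.cellP17C6_poly, S2.cellP17C6_tail⟩

/-- **The `e`-free core at level `5`, rank `17`, corank `10`**: the quart XMid core, `N_mid = 1716·⌊(27 − 8)/2⌋ = 15444`
(S2MidFlatsTenD at `|E| = 27`), `s₃ ≤ 20`, `s₄ ≤ 188`, `s₅ ≤ 1518`; slack `140/1024`. -/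
theorem c025_core_five_seventeen_ten (M : Matroid α) [M.Finite]
    (hR : M.eRank = ((17 : ℕ) : ℕ∞)) (hn : M.E.ncard = 17 + 10)
    (hfree : ∀ e ∈ M.E, ∃ A ⊆ M.E \ {e}, e ∉ M.closure A ∧ e ∉ M.closure ((M.E \ {e}) \ A)) :
    RLS M 17 5 := by
  have hL0 : ∀ e ∈ M.E, ¬ M.IsLoop e := not_isLoop_of_free M hfree
  have hd : M.E.encard = M.eRank + 10 := by
    rw [hR, ← M.ground_finite.cast_ncard_eq, hn]
    push_cast
    ring
  have hs : ∀ e ∈ M.E, ∀ f ∈ M.E, e ≠ f → M.eRk {e, f} = 2 := by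
    intro e he f hf hef
    have h2 : (2 : ℕ∞) ≤ M.eRk {e, f} :=
      two_le_eRk_of_two_le_ncard_of_free M hfree (pair_subset he hf) (by rw [ncard_pair hef])
    have h3 : M.eRk {e, f} ≤ 2 := by
      have := M.eRk_le_encard {e, f}
      rwa [encard_pair hef] at this
    exact le_antisymm h3 h2
  have hC1 : ∀ L ⊆ M.E, M.eRk L = 2 → L.ncard ≤ 3 :=
    fun L hL hr => ncard_le_three_of_eRk_two M hs hfree hL hr
  have hflat' : ∀ X ⊆ M.E, M.eRk X ≤ ((5 - 1 : ℕ) : ℕ∞) → X.ncard ≤ 10 := fun X hX hr =>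
    ncard_le_ten_of_eRk_le_four_of_free M hfree hX (by simpa using hr)
  have hC2 : ∀ P ⊆ M.E, M.eRk P ≤ 3 → P.ncard ≤ 6 :=
    fun P hP hr => ncard_le_six_of_eRk_le_three_of_free M hfree hP hr
  have hC0 : ∀ X ⊆ M.E, M.eRk X ≤ 1 → X.ncard ≤ 1 := fun X hX hr => by
    have := ncard_add_one_le_two_pow_of_eRk_le M hL0 hfree 1 X hX hr
    omega
  have hmid := S2.card_spanMid_le_ten_sharp hC1 hflat' hC2 hC0 hd (by omega)
  have hmid' : (S2.spanMid M 5 (min 10 (4 + 10)) ((10 + 6) / 2 + 1)).card ≤ 1716 * ((27 - 8) / 2) := by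
    rw [show min 10 (4 + 10) = 10 by norm_num, show (10 + 6) / 2 + 1 = 9 by norm_num]
    calc (S2.spanMid M 5 10 9).card ≤ 1716 * ((M.E.ncard - 8) / 2) := hmid
      _ = 1716 * ((27 - 8) / 2) := by rw [hn]
  have hs3 := TriangleCap.core_ncard_triangles_le_cq3 M hfree hd
  rw [show TriangleCap.cq3 10 = 20 by decide +kernel] at hs3
  have hs4 := ncard_fourCircuits_le_avgChain16 10 M hfree hd
  rw [avgChain16_values.2.2.2.1] at hs4
  have hs5 := S1.ncard_fiveCircuits_le_avgChain5b 10 M hfree hd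
  rw [S1.avgChain5b_values.2.2.2] at hs5
  have key := c025_core_five_sharp_cell_xmidctq M 17 10 (1716 * ((27 - 8) / 2)) (by norm_num) hR hn hfree 20 188 1518
    hs3 hs4 hs5 hmid'
  exact key ⟨140, by norm_num, S2.cellP17XM10_poly, S2.cellP17XM10_tail⟩

/-- **The `e`-free core at level `5`, rank `17`, every corank `6 ≤ d ≤ 31`**. -/
theorem c025_core_five_seventeen_xx (M : Matroid α) [M.Finite] (d : ℕ)
    (hd6 : 6 ≤ d) (hd31 : d ≤ 31) (hR : M.eRank = ((17 : ℕ) : ℕ∞)) (hn : M.E.ncard = 17 + d)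
    (hfree : ∀ e ∈ M.E, ∃ A ⊆ M.E \ {e}, e ∉ M.closure A ∧ e ∉ M.closure ((M.E \ {e}) \ A)) :
    RLS M 17 5 := by
  by_cases h6 : d = 6
  · subst h6; exact c025_core_five_seventeen_six M hR hn hfree
  by_cases h7 : d = 7
  · subst h7; exact c025_core_five_seventeen_seven M hR hn hfree
  by_cases h8 : d = 8
  · subst h8; exact c025_core_five_seventeen_eight M hR hn hfree
  by_cases h9 : d = 9
  · subst h9; exact c025_core_five_seventeen_nine M hR hn hfree
  by_cases h10 : d = 10
  · subst h10; exact c025_core_five_seventeen_ten M hR hn hfree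
  have hd : M.E.encard = M.eRank + d := by
    rw [hR, ← M.ground_finite.cast_ncard_eq, hn]
    push_cast
    ring
  have hs3 := TriangleCap.core_ncard_triangles_le_cq3 M hfree hd
  have hs4 := ncard_fourCircuits_le_avgChain16 d M hfree hd
  have hs5 := S1.ncard_fiveCircuits_le_avgChain5b d M hfree hd
  exact c025_core_five_sharp_cell_xqictq5 M 17 d hd6 (by norm_num) hR hn hfree (TriangleCap.cq3 d) (avgChain16 d)
    (S1.avgChain5b d) hs3 hs4 hs5 (S2.cellsP17Q d (by omega) hd31)

/-- **THEOREM C₅, GIVEN LEVEL `4` FROM `P ≥ 17`**: level `4` for all `p ≥ P` implies level `5` for all `p ≥ P + 1`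
(the `p = 17` row by `c025_core_five_seventeen_xx` / `c025_core_five_at_seventeen_big`, the `p = 18` row by the «19» kit's
`c025_core_five_eighteen_xx` / `c025_core_five_at_eighteen_big`, the rows `p ≥ 19` by `c025_five_of_four_cq_xix_from`). -/
theorem c025_five_of_four_cq_xviii_from (P : ℕ) (hP : 17 ≤ P)
    (h4 : ∀ (M : Matroid α) [M.Finite] (p : ℕ), P ≤ p → RLS M p 4) :
    ∀ (M : Matroid α) [M.Finite] (p : ℕ), P + 1 ≤ p → RLS M p 5 := by
  rcases Nat.lt_or_ge P 18 with hP17 | hP18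
  · have hP' : P = 17 := by omega
    subst hP'
    refine S2.rls_five_of_four_of_core 17 (by omega) h4 ?_
    intro M _ p hP' hR hbig hfree
    rcases Nat.lt_or_ge p 18 with h17 | h18
    · have hp' : p = 17 := by omega
      subst hp'
      rcases Nat.lt_or_ge M.E.ncard (17 + 32) with h | h
      · exact c025_core_five_seventeen_xx M (M.E.ncard - 17) (by omega) (by omega) hR (by omega) hfree
      · exact c025_core_five_at_seventeen_big M (by omega) hfree
    rcases Nat.lt_or_ge p 19 with h18' | h19
    · have hp' : p = 18 := by omega
      subst hp'
      rcases Nat.lt_or_ge M.E.ncard (18 + 30) with h | h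
      · exact c025_core_five_eighteen_xx M (M.E.ncard - 18) (by omega) (by omega) hR (by omega) hfree
      · exact c025_core_five_at_eighteen_big M (by omega) hfree
    · exact c025_five_of_four_cq_xix_from 18 le_rfl (fun M _ p hp => h4 M p (by omega)) M p h19
  · exact c025_five_of_four_cq_xix_from P hP18 h4

/-- **THEOREM C₅ AT `18`**: every finite matroid satisfies C-025 at level `5` for every `p ≥ 18` (level `4` from S1's
`c025_four_seventeen`). -/
theorem c025_five_large_sharp18 (M : Matroid α) [M.Finite] (p : ℕ) (hp : 18 ≤ p) : RLS M p 5 :=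
  c025_five_of_four_cq_xviii_from 17 le_rfl (fun M _ p hp => S1.c025_four_seventeen M p (by omega)) M p hp

/-- The level-`5` statement at `p ≥ 18` in the vocabulary of `C025`. -/
theorem c025_five_large_sharp18' (M : Matroid α) [M.Finite] (p : ℕ) (hp : 18 ≤ p) :
    phiK p 5 * ({A : Set α | A ⊆ M.E ∧ M.eRk A = (p : ℕ∞) ∧ M.eRk (M.E \ A) = (5 : ℕ∞)}.ncard : ℚ) ≤
      ({A : Set α | A ⊆ M.E ∧ (5 : ℕ∞) < M.eRk A ∧ M.eRk A < (p : ℕ∞)}.ncard : ℚ) :=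
  c025_five_large_sharp18 M p hp

end ThmN

end PercRepro
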